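import Summits.QuantumFields.YangMills.Theorems.UnitScaleTiltProp7TJRowOfColumns
import Summits.QuantumFields.YangMills.Theorems.UnitScaleTiltProp7CmapTwSCoarseColumn
import HarnessLib

/-!
# «TJ-ROW DOOR», SEQUEL — the local-Hessian column row `hq` of ✓`Prop7TJRowOfColumns.hTJ_of_hHcol_hq` IS A COROLLARY OF THE DISPLAY's (157) ENTRY ROW `hC157`, hence
# **S20ᴸ's operator row `hTJ` follows from S20ᴸ's `hHcol` ∧ `hC157` with NO new displayed row** (`kTJ L := 12·α L·ΘH L·g L`); def-free

Cell `ym3-torus` (HUMAN RULING D-0037, YM ladder rung R3 — YM₃ on T³, NOT d = 4, NOT Clay; YM gap NOT proved), width seat `ym3-torus-px13` (gen 5, explicit-unit helper).  THEOREMS ONLY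
(0 `def`, 0 `sorry`); `--supports stmt-QuantumFields-19200 --as helper`, count-neutral; NO claim on crux ∕ stub ∕ registry.  Route `UnitScaleTilt`, crux «MinimiserStabilityRegPr»
(stmt-QuantumFields-19200), stub `stub_existenceMinimalOrbit` (EX), display of record S20ᴸ ✓p690345 (rows `hHcol` :143–146, `hC157` :148–151, `hTJ` :212–214).

THE PRINT.  [Balaban1985BackgroundPropagators] p. 393 (3.14): «C_j(U, A) is an analytic function of A whose expansion begins with second order terms»; p. 421 (3.127) (the J-term
`−2⟨HC⁽²⁾(A), J⟩`); p. 423 (3.137).  [Balaban1985Averaging] Prop. 5 (157) p. 42 (the derivative of the averaging remainder); (110) p. 34 (locality).  [Balaban1985Variational] (72)–(73) p. 289.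

THE MATHEMATICS.  `avgHess U₀ = D²(log U̿^{twS})(0)` (✓`avgHess_def`).  On the ball `B(0, e·η)` where the log-chart is analytic (W5 ✓`analyticOnNhd_logChartTwS`, windows `10⁹L²e ≤ 1`,
`10¹²L³ε₀ ≤ 1`), `fderiv (log U̿)(B) − fderiv (log U̿)(0) = fderiv C(U₀,·)(B)` (✓`CmapTwS_apply`, ✓`QTwS_def`).  For a one-bond direction `δ = δ_bd·E` the display's `hC157` bounds every
entry `‖(fderiv C(B) δ)(c)‖ ≤ g′·‖B‖·‖δ‖` (`g′ = g·(L^{K−n})⁻¹`, `‖B‖ < (ε_C + a₃)·η`), and ★px18 ✓`sum_norm_fderiv_CmapTwS_apply_le_of_entry_row` sums the coarse column: `≤ 6·g′·‖B‖·‖δ‖`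
(only the `2d = 6` coarse bonds incident to `B^{K−n}(bd₋)` read `bd`).  A second derivative at `0` inherits such a first-derivative column bound near `0` (§4: difference quotients
along `t ↦ t•X′`, `HasDerivAt.tendsto_slope_zero`, `le_of_tendsto`): `Σ_y ‖avgHess U₀ X′ (δ_bd·E) y‖ ≤ 6·g′·sup‖X′‖·‖E‖` — the row `hq` with `qA := 6·g`.  Then ✓`hTJ_of_hHcol_hq`.
DIMENSION LINE: `kTJ = 2·α·ΘH·(6g) = 12·α·ΘH·g` — L-only.

WHAT IS PROVED (ns `…Theorems.Prop7TJRowOfEntry157`):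
* §4 `sum_norm_fderiv_fderiv_le_of_column` [folklore calculus]; ★★`sum_norm_avgHess_single_le_of_entry_row` — `hq` at the member FROM the (157) entry row (`qA := 6·g`).
* §5 ★★★`hTJ_of_hHcol_h157` — S20ᴸ's `hTJ` TOKEN FOR TOKEN with `kTJ L := 12·α L·ΘH L·g L`, from S20ᴸ's `hHcol` and `hC157` VERBATIM plus the display's letters `ha₃ hα hΘH0 hg0 hef hWe hWε hεC`;
  the display may instantiate `kTJ := fun L ↦ 12 * α L * ΘH L * g L` and drop the row `hTJ`.
HONEST SCOPE.  Calculus bookkeeping; `hHcol` (N06) and `hC157` ((157) class) stay DISPLAYED, not proved; nothing of the stub, the crux, d = 4 or the mass gap is claimed.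

References: T. Bałaban, CMP **99** (1985) 389–434 [Balaban1985BackgroundPropagators] ((3.13)–(3.14) p.393, (3.126)–(3.128) pp.420–421, (3.137) p.423); CMP **98** (1985) 17–51
[Balaban1985Averaging] ((110) p.34, Prop. 5 (157) p.42); CMP **102** (1985) 277–309 [Balaban1985Variational] ((27)–(28) p.282, (72)–(73) p.289).
-/

set_option autoImplicit false

noncomputable section

open scoped InnerProductSpace ComplexConjugate Matrix.Norms.L2Operator BigOperators Matrix

namespace Summit.QuantumFields.YangMills.Theorems.Prop7TJRowOfEntry157

open Literature.MathematicalPhysics.QuantumFieldTheory.Balaban1983to89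
open Literature.MathematicalPhysics.QuantumFieldTheory.Balaban1983to89.T3ContinuumYM3Torus
open Literature.MathematicalPhysics.QuantumFieldTheory.Balaban1983to89.T3Thm1Carrier (Idx)
open T3SectALandauChart (eta eta_pos)
open T3PrintedRegularMinimiser (RegPr)
open B9SectCLatticeCarrier (Bond)
open B11Eq90V0primeCurrent (flat115)
open Summit.QuantumFields.YangMills.Theorems.Prop7SectET3Transport (periodsT3)
open Summit.QuantumFields.YangMills.Theorems.Prop7SectET3HilbertLetters (toL2)
open Summit.QuantumFields.YangMills.Theorems.Prop7SectET3CurvedPropagators (H1f)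
open Summit.QuantumFields.YangMills.Theorems.Prop7SectET3DeltaPiPInv (DeltaPiSlotP)
open Summit.QuantumFields.YangMills.Theorems.Prop7SectET3DeltaOne (avgHess avgHess_def)
open Summit.QuantumFields.YangMills.Theorems.Prop7SectET3DeltaOnePInv (TJSlotP)
open Summit.QuantumFields.YangMills.Theorems.Prop7SymAvgTwSym (logChartTwS QTwS CmapTwS QTwS_def CmapTwS_apply)
open Summit.QuantumFields.YangMills.Theorems.Prop7CmapTwSymInputs (analyticOnNhd_logChartTwS)
open Summit.QuantumFields.YangMills.Theorems.Prop7CmapTwSCoarseColumn (sum_norm_fderiv_CmapTwS_apply_le_of_entry_row)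
open Summit.QuantumFields.YangMills.Theorems.Prop7TJRowOfColumns (hTJ_of_hHcol_hq)
open Filter Topology Metric Set

variable {F : T3Family} {n K : ℕ} {h : n ≤ K}

/-! ## §4 The row (q) is NOT new: it follows from the display's (157) entry row `hC157` — the second derivative at `0` inherits the first-derivative column near `0` -/

/-- **A SECOND DERIVATIVE AT `0` INHERITS A FIRST-DERIVATIVE COLUMN BOUND NEAR `0`** [folklore calculus]: if `f` is analytic on `B(0, ρ)` and the remainder derivative
`fderiv f B − fderiv f 0` has its `δ`-column `Σ_y ‖(fderiv f B − fderiv f 0) δ y‖ ≤ m·‖B‖` for `‖B‖ < r`, then `Σ_y ‖D²f(0)[X′][δ] y‖ ≤ m·‖X′‖` (difference quotients along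
`t ↦ t•X′`, `HasDerivAt.tendsto_slope_zero`, `le_of_tendsto`). [folklore] -/
theorem sum_norm_fderiv_fderiv_le_of_column {ι κ : Type*} [Fintype ι] [Fintype κ]
    {f : (ι → Matrix (Fin 2) (Fin 2) ℂ) → (κ → Matrix (Fin 2) (Fin 2) ℂ)} {ρ r m : ℝ} (hρ : 0 < ρ) (hr : 0 < r)
    (hf : AnalyticOnNhd ℂ f (ball 0 ρ)) (δ X' : ι → Matrix (Fin 2) (Fin 2) ℂ)
    (hcol : ∀ B : ι → Matrix (Fin 2) (Fin 2) ℂ, ‖B‖ < r → ∑ y, ‖(fderiv ℂ f B - fderiv ℂ f 0) δ y‖ ≤ m * ‖B‖) :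
    ∑ y, ‖fderiv ℂ (fun A => fderiv ℂ f A) 0 X' δ y‖ ≤ m * ‖X'‖ := by
  -- `fderiv f` is differentiable at `0`; evaluate at `δ` (a continuous linear operation) and restrict to the complex line `t ↦ t • X'`
  have hD : HasFDerivAt (fun A => fderiv ℂ f A) (fderiv ℂ (fun A => fderiv ℂ f A) 0) 0 :=
    ((hf.fderiv 0 (mem_ball_self hρ)).differentiableAt).hasFDerivAt
  have hevδ : HasFDerivAt (fun A => fderiv ℂ f A δ)
      ((ContinuousLinearMap.apply ℂ (κ → Matrix (Fin 2) (Fin 2) ℂ) δ).comp (fderiv ℂ (fun A => fderiv ℂ f A) 0)) 0 :=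
    (ContinuousLinearMap.apply ℂ (κ → Matrix (Fin 2) (Fin 2) ℂ) δ).hasFDerivAt.comp 0 hD
  have hline : HasDerivAt (fun t : ℂ => t • X') X' 0 := by simpa using (hasDerivAt_id (0 : ℂ)).smul_const X'
  have hg : HasDerivAt (fun t : ℂ => fderiv ℂ f (t • X') δ) (fderiv ℂ (fun A => fderiv ℂ f A) 0 X' δ) 0 := by
    have hc := HasFDerivAt.comp_hasDerivAt (l := fun A => fderiv ℂ f A δ)
      (l' := (ContinuousLinearMap.apply ℂ (κ → Matrix (Fin 2) (Fin 2) ℂ) δ).comp (fderiv ℂ (fun A => fderiv ℂ f A) 0))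
      (f := fun t : ℂ => t • X') (f' := X') (x := (0 : ℂ)) (by simpa only [zero_smul] using hevδ) hline
    simpa only [Function.comp_def, ContinuousLinearMap.comp_apply, ContinuousLinearMap.apply_apply] using hc
  have hslope := hg.tendsto_slope_zero
  simp only [zero_add, zero_smul] at hslope
  -- the continuous functional `v ↦ Σ_y ‖v y‖`
  have hΨc : Continuous (fun v : κ → Matrix (Fin 2) (Fin 2) ℂ => ∑ y, ‖v y‖) := continuous_finsetSum _ fun y _ => (continuous_apply y).norm
  have hlim : Tendsto (fun t : ℂ => ∑ y, ‖(t⁻¹ • (fderiv ℂ f (t • X') δ - fderiv ℂ f 0 δ)) y‖) (𝓝[≠] 0)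
      (𝓝 (∑ y, ‖fderiv ℂ (fun A => fderiv ℂ f A) 0 X' δ y‖)) := (hΨc.tendsto _).comp hslope
  -- the difference quotients obey the bound eventually
  have hev : ∀ᶠ t : ℂ in 𝓝[≠] 0, ∑ y, ‖(t⁻¹ • (fderiv ℂ f (t • X') δ - fderiv ℂ f 0 δ)) y‖ ≤ m * ‖X'‖ := by
    have hball : ∀ᶠ t : ℂ in 𝓝 0, ‖t‖ < r / (‖X'‖ + 1) := by
      have hpos : 0 < r / (‖X'‖ + 1) := div_pos hr (by positivity)
      exact Metric.eventually_nhds_iff.2 ⟨r / (‖X'‖ + 1), hpos, fun t ht => by simpa [dist_zero_right] using ht⟩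
    filter_upwards [eventually_nhdsWithin_of_eventually_nhds hball, self_mem_nhdsWithin] with t ht ht0
    have ht0' : t ≠ 0 := ht0
    have htn : 0 < ‖t‖ := norm_pos_iff.2 ht0'
    have hB : ‖t • X'‖ < r := by
      rw [norm_smul]
      have h1 : ‖t‖ * (‖X'‖ + 1) < r := by rwa [lt_div_iff₀ (by positivity)] at ht
      nlinarith [norm_nonneg X', norm_nonneg t]
    have hq := hcol (t • X') hB
    rw [norm_smul] at hq
    have hterm : ∀ y, ‖(t⁻¹ • (fderiv ℂ f (t • X') δ - fderiv ℂ f 0 δ)) y‖ = ‖t‖⁻¹ * ‖(fderiv ℂ f (t • X') - fderiv ℂ f 0) δ y‖ := fun y => by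
      rw [Pi.smul_apply, norm_smul, norm_inv, ← sub_apply]
    simp only [hterm, ← Finset.mul_sum]
    calc ‖t‖⁻¹ * ∑ y, ‖(fderiv ℂ f (t • X') - fderiv ℂ f 0) δ y‖ ≤ ‖t‖⁻¹ * (m * (‖t‖ * ‖X'‖)) := mul_le_mul_of_nonneg_left hq (inv_nonneg.2 htn.le)
      _ = m * ‖X'‖ := by field_simp
  exact le_of_tendsto hlim hev

/-- ★★ **(q) FROM THE (157) ENTRY ROW — THE LOCAL HESSIAN COLUMN IS A COROLLARY OF `hC157`**: at `U₀ ∈ 𝔘_k(ε₀)` in the windows `10⁹L²e ≤ 1`, `10¹²L³ε₀ ≤ 1`, if the chart remainder's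
derivative obeys the one-bond entry row `‖(fderiv C(U₀,·) B δ)(c)‖ ≤ g′·‖B‖·‖δ‖` for `‖B‖ < r` and `δ` supported on one fine bond (the display's `hC157` at the member, `g′ = g·(L^{K−n})⁻¹`,
`r = (ε_C + a₃)·η`), then **`Σ_y ‖avgHess U₀ X′ (δ_bd·E) y‖ ≤ 6·g′·s·‖E‖`** for `sup_b ‖X′ b‖ ≤ s`: `avgHess = D²(log U̿^{twS})(0)` (✓`avgHess_def`), `fderiv (log U̿)(B) − Q = fderiv C(B)`
on the ball (✓`CmapTwS_apply`, ✓`QTwS_def`, W5 ✓`analyticOnNhd_logChartTwS`), the `2d = 6` coarse-column count of ★px18 ✓`sum_norm_fderiv_CmapTwS_apply_le_of_entry_row`, and §4's limit.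
[cite: Balaban1985Averaging, Prop. 5 (157) p.42, (110) p.34; Balaban1985BackgroundPropagators, (3.13)–(3.14) p.393; Balaban1985Variational, (72)–(73) p.289] -/
theorem sum_norm_avgHess_single_le_of_entry_row [Fact (0 < (F.L : ℝ))] [Fact (0 < ((F.L : ℝ)⁻¹) ^ (K - n))]
    {ε₀ e r g' : ℝ} (hε₀ : 0 < ε₀) (he : 0 < e) (hWe : 10 ^ 9 * (F.L : ℝ) ^ 2 * e ≤ 1) (hWε : 10 ^ 12 * (F.L : ℝ) ^ 3 * ε₀ ≤ 1) (hr : 0 < r) (hg' : 0 ≤ g')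
    (U₀ : GaugeField (F.P K) 0 (Matrix.specialUnitaryGroup (Fin 2) ℂ)) (hreg : RegPr F n K ε₀ U₀)
    (h157 : ∀ B : PBond (F.P K) 0 → Matrix (Fin 2) (Fin 2) ℂ, ‖B‖ < r →
      ∀ (b₀ : PBond (F.P K) 0) (δ : PBond (F.P K) 0 → Matrix (Fin 2) (Fin 2) ℂ), (∀ b, b ≠ b₀ → δ b = 0) →
      ∀ c : PBond (F.P n) 0, ‖fderiv ℂ (CmapTwS F n K h U₀) B δ c‖ ≤ g' * ‖B‖ * ‖δ‖) :
    ∀ (X' : PBond (F.P K) 0 → Matrix (Fin 2) (Fin 2) ℂ) (s : ℝ) (bd : PBond (F.P K) 0) (E : Matrix (Fin 2) (Fin 2) ℂ), (∀ b, ‖X' b‖ ≤ s) →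
      ∑ y : PBond (F.P n) 0, ‖avgHess F n K h U₀ X' (Pi.single bd E) y‖ ≤ 6 * g' * s * ‖E‖ := by
  intro X' s bd E hX'
  have hη : 0 < eta F n K := eta_pos F n K
  have hρ : 0 < e * eta F n K := mul_pos he hη
  have hs : 0 ≤ s := (norm_nonneg _).trans (hX' bd)
  have hXs : ‖X'‖ ≤ s := (pi_norm_le_iff_of_nonneg hs).2 hX'
  have han := analyticOnNhd_logChartTwS F h hε₀ he hWe hWε U₀ hreg
  have hδsupp : ∀ b, b ≠ bd → (Pi.single bd E : PBond (F.P K) 0 → Matrix (Fin 2) (Fin 2) ℂ) b = 0 := fun b hb => by rw [Pi.single_eq_of_ne hb]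
  have hδn : ‖(Pi.single bd E : PBond (F.P K) 0 → Matrix (Fin 2) (Fin 2) ℂ)‖ = ‖E‖ := by rw [Pi.norm_single]
  -- on the ball, `fderiv (log U̿)(B) − fderiv (log U̿)(0) = fderiv C(B)`
  have hrem : ∀ B : PBond (F.P K) 0 → Matrix (Fin 2) (Fin 2) ℂ, ‖B‖ < e * eta F n K →
      fderiv ℂ (logChartTwS F n K h U₀) B - fderiv ℂ (logChartTwS F n K h U₀) 0 = fderiv ℂ (CmapTwS F n K h U₀) B := by
    intro B hB
    have hfun : CmapTwS F n K h U₀ = fun A => logChartTwS F n K h U₀ A - QTwS F n K h U₀ A := by funext A; rw [CmapTwS_apply]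
    have hdiff : DifferentiableAt ℂ (logChartTwS F n K h U₀) B := (han B (mem_ball_zero_iff.2 hB)).differentiableAt
    rw [hfun, fderiv_fun_sub hdiff (QTwS F n K h U₀).differentiableAt, ContinuousLinearMap.fderiv, QTwS_def]
  -- the column bound of the remainder derivative, radius `min r (e·η)`
  have hcol : ∀ B : PBond (F.P K) 0 → Matrix (Fin 2) (Fin 2) ℂ, ‖B‖ < min r (e * eta F n K) →
      ∑ y : PBond (F.P n) 0, ‖(fderiv ℂ (logChartTwS F n K h U₀) B - fderiv ℂ (logChartTwS F n K h U₀) 0) (Pi.single bd E) y‖ ≤ 6 * g' * ‖E‖ * ‖B‖ := by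
    intro B hB
    have hBr : ‖B‖ < r := hB.trans_le (min_le_left _ _)
    have hBe : ‖B‖ < e * eta F n K := hB.trans_le (min_le_right _ _)
    rw [hrem B hBe]
    have hM : 0 ≤ g' * ‖B‖ * ‖E‖ := mul_nonneg (mul_nonneg hg' (norm_nonneg _)) (norm_nonneg _)
    have hent : ∀ c : PBond (F.P n) 0, ‖fderiv ℂ (CmapTwS F n K h U₀) B (Pi.single bd E) c‖ ≤ g' * ‖B‖ * ‖E‖ := fun c => by
      have h1 := h157 B hBr bd (Pi.single bd E) hδsupp c
      rwa [hδn] at h1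
    have hsix := sum_norm_fderiv_CmapTwS_apply_le_of_entry_row F n K h hε₀ he hWe hWε U₀ hreg hBe bd (Pi.single bd E) hδsupp hM (fun c _ => hent c)
    calc ∑ y : PBond (F.P n) 0, ‖fderiv ℂ (CmapTwS F n K h U₀) B (Pi.single bd E) y‖ ≤ 6 * (g' * ‖B‖ * ‖E‖) := hsix
      _ = 6 * g' * ‖E‖ * ‖B‖ := by ring
  have h6 : (0 : ℝ) ≤ 6 * g' * ‖E‖ := mul_nonneg (mul_nonneg (by norm_num) hg') (norm_nonneg _)
  have hmain := sum_norm_fderiv_fderiv_le_of_column hρ (lt_min hr hρ) han (Pi.single bd E) X' hcol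
  rw [avgHess_def]
  calc ∑ y : PBond (F.P n) 0, ‖fderiv ℂ (fun A => fderiv ℂ (logChartTwS F n K h U₀) A) 0 X' (Pi.single bd E) y‖ ≤ 6 * g' * ‖E‖ * ‖X'‖ := hmain
    _ ≤ 6 * g' * ‖E‖ * s := mul_le_mul_of_nonneg_left hXs h6
    _ = 6 * g' * s * ‖E‖ := by ring

/-! ## §5 ★★★ The family door with NO new row: `hTJ ⟸ hHcol ∧ hC157` (both displayed in S20ᴸ ✓p690345) -/

/-- ★★★ **THE FAMILY DOOR `hTJ ⟸ hHcol ∧ hC157` — THE EX DISPLAY's OPERATOR ROW `hTJ` IS A COROLLARY OF TWO ROWS IT ALREADY DISPLAYS.**  S20ᴸ's (✓p690345) binder `hTJ` TOKEN FOR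
TOKEN with `kTJ L := 12·α L·ΘH L·g L`, from S20ᴸ's binders `hHcol` (the `ℓ¹`-column of print's `H` (3.126), [B9] Thm 3.12 (3.133) class) and `hC157` ([Balaban1985Averaging] Prop. 5 (157) for the
chart of record) VERBATIM, plus the display's positivity∕window letters `hα ha₃ hεC hef hWe hWε hΘH0 hg0`.  Chain: (J) ✓`norm_actionGrad_le_of_regPr` ((28) at `RegPr`), (H) ✓`sum_norm_H46P_le_of_column`,
(q) ✓`sum_norm_avgHess_single_le_of_entry_row` (`qA := 6·g`), duality ✓`norm_TJP_apply_le_of_columns`.  Dimension line: `(2∕η²)·(η³α)·(η·ΘH·η⁻³)·(6g·η) = 12·α·ΘH·g`.  After this door the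
display may instantiate `kTJ := fun L ↦ 12 * α L * ΘH L * g L` and drop the row.  CONDITIONAL on the displayed rows; nothing of the stub, the crux, d = 4 or the gap is claimed.
[cite: Balaban1985BackgroundPropagators, (3.137) p.423, (3.127)–(3.128) p.421, (3.126) p.420, (3.133) p.422, (3.11)–(3.14) pp.392–393; Balaban1985Averaging, Prop. 5 (157) p.42, (110) p.34; Balaban1985Variational, (27)–(28) p.282, (72)–(73) p.289] -/
theorem hTJ_of_hHcol_h157
    [hFL : ∀ F : T3Family, Fact (0 < (F.L : ℝ))] [hFη : ∀ (F : T3Family) (k : ℕ), Fact (0 < ((F.L : ℝ)⁻¹) ^ k)]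
    (a₃ α : ℕ → ℝ) (ha₃ : ∀ L, 1 < L → 0 < a₃ L) (hα : ∀ L, 1 < L → 0 < α L)
    (c₀ cB : ℕ → ℝ) [hc₀ : ∀ L : ℕ, Fact (0 < c₀ L)] [hcB : ∀ L : ℕ, Fact (0 < cB L)]
    (a : ∀ L : ℕ, Idx L → ℝ)
    (εC : ℕ → ℝ) (ΘH g : ℕ → ℝ) (hΘH0 : ∀ L, 1 < L → 0 ≤ ΘH L) (hg0 : ∀ L, 1 < L → 0 ≤ g L)
    (hHcol : ∀ (L : ℕ), 1 < L → ∀ (i : Idx L) (U₀ : GaugeField (i.1.1.P i.1.2.2) 0 (Matrix.specialUnitaryGroup (Fin 2) ℂ)), RegPr i.1.1 i.1.2.1 i.1.2.2 (α L) U₀ →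
      ∃ hk : Bond 3 (periodsT3 i.1.1 i.1.2.2) → PBond (i.1.1.P i.1.2.1) 0 → ℝ, (∀ b' y, 0 ≤ hk b' y) ∧
        (∀ (y : PBond (i.1.1.P i.1.2.1) 0) (Z : Matrix (Fin 2) (Fin 2) ℂ) (b' : Bond 3 (periodsT3 i.1.1 i.1.2.2)), ‖flat115 ((H1f i.1.1 i.1.2.1 i.1.2.2 i.2.2.le (c₀ L) (cB L) (a L i) (DeltaPiSlotP i.1.1 i.1.2.1 i.1.2.2 i.2.2.le (c₀ L) (cB L) (a L i)) U₀) (Pi.single y Z)) b'‖ ≤ hk b' y * ‖Z‖) ∧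
        (∀ y : PBond (i.1.1.P i.1.2.1) 0, ∑ b' : Bond 3 (periodsT3 i.1.1 i.1.2.2), hk b' y ≤ ΘH L * ((L : ℝ) ^ (i.1.2.2 - i.1.2.1)) ^ 3))
    (hC157 : ∀ (L : ℕ), 1 < L → ∀ (i : Idx L) (U₀ : GaugeField (i.1.1.P i.1.2.2) 0 (Matrix.specialUnitaryGroup (Fin 2) ℂ)), RegPr i.1.1 i.1.2.1 i.1.2.2 (α L) U₀ →
      ∀ B : PBond (i.1.1.P i.1.2.2) 0 → Matrix (Fin 2) (Fin 2) ℂ, ‖B‖ < (εC L + a₃ L) * eta i.1.1 i.1.2.1 i.1.2.2 →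
      ∀ (b₀ : PBond (i.1.1.P i.1.2.2) 0) (δ : PBond (i.1.1.P i.1.2.2) 0 → Matrix (Fin 2) (Fin 2) ℂ), (∀ b, b ≠ b₀ → δ b = 0) →
      ∀ c : PBond (i.1.1.P i.1.2.1) 0, ‖fderiv ℂ (CmapTwS i.1.1 i.1.2.1 i.1.2.2 i.2.2.le U₀) B δ c‖ ≤ g L * ((L : ℝ) ^ (i.1.2.2 - i.1.2.1))⁻¹ * ‖B‖ * ‖δ‖)
    (ef : ℕ → ℝ) (hef : ∀ L, 1 < L → 0 < ef L)
    (hWe : ∀ L : ℕ, 1 < L → 10 ^ 9 * (L : ℝ) ^ 2 * ef L ≤ 1) (hWε : ∀ L : ℕ, 1 < L → 10 ^ 12 * (L : ℝ) ^ 3 * α L ≤ 1)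
    (hεC : ∀ L : ℕ, 1 < L → 0 ≤ εC L) :
    ∀ (L : ℕ), 1 < L → ∀ (i : Idx L) (U₀ : GaugeField (i.1.1.P i.1.2.2) 0 (Matrix.specialUnitaryGroup (Fin 2) ℂ)), RegPr i.1.1 i.1.2.1 i.1.2.2 (α L) U₀ →
      ∀ (X : PBond (i.1.1.P i.1.2.2) 0 → Matrix (Fin 2) (Fin 2) ℂ) (s : ℝ), (∀ bd, ‖X bd‖ ≤ s) →
        ∀ bd : PBond (i.1.1.P i.1.2.2) 0, ‖(toL2 i.1.1 i.1.2.2 (c₀ L)).symm (TJSlotP i.1.1 i.1.2.1 i.1.2.2 i.2.2.le (c₀ L) (cB L) (a L i) U₀ (toL2 i.1.1 i.1.2.2 (c₀ L) X)) bd‖ ≤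
          12 * α L * ΘH L * g L * s := by
  -- the (q) row at `qA := 6·g` from `hC157`, member by member
  have hq : ∀ (L : ℕ), 1 < L → ∀ (i : Idx L) (U₀ : GaugeField (i.1.1.P i.1.2.2) 0 (Matrix.specialUnitaryGroup (Fin 2) ℂ)), RegPr i.1.1 i.1.2.1 i.1.2.2 (α L) U₀ →
      ∀ (X' : PBond (i.1.1.P i.1.2.2) 0 → Matrix (Fin 2) (Fin 2) ℂ) (s : ℝ) (bd : PBond (i.1.1.P i.1.2.2) 0) (E : Matrix (Fin 2) (Fin 2) ℂ), (∀ b, ‖X' b‖ ≤ s) →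
        ∑ y : PBond (i.1.1.P i.1.2.1) 0, ‖avgHess i.1.1 i.1.2.1 i.1.2.2 i.2.2.le U₀ X' (Pi.single bd E) y‖ ≤ (6 * g L) * ((L : ℝ) ^ (i.1.2.2 - i.1.2.1))⁻¹ * s * ‖E‖ := by
    intro L hL i U₀ hU X' s bd E hX'
    have hLi : (i.1.1.L : ℝ) = (L : ℝ) := by exact_mod_cast i.2.1
    have hLpos : (0 : ℝ) < L := by exact_mod_cast (zero_lt_one.trans hL)
    have hWe' : 10 ^ 9 * (i.1.1.L : ℝ) ^ 2 * ef L ≤ 1 := by rw [hLi]; exact hWe L hL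
    have hWε' : 10 ^ 12 * (i.1.1.L : ℝ) ^ 3 * α L ≤ 1 := by rw [hLi]; exact hWε L hL
    have hr : 0 < (εC L + a₃ L) * eta i.1.1 i.1.2.1 i.1.2.2 := mul_pos (by linarith [hεC L hL, ha₃ L hL]) (eta_pos _ _ _)
    have hg' : 0 ≤ g L * ((L : ℝ) ^ (i.1.2.2 - i.1.2.1))⁻¹ := by have := hg0 L hL; positivity
    have h := sum_norm_avgHess_single_le_of_entry_row (h := i.2.2.le) (hα L hL) (hef L hL) hWe' hWε' hr hg' U₀ hU (hC157 L hL i U₀ hU) X' s bd E hX'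
    calc ∑ y : PBond (i.1.1.P i.1.2.1) 0, ‖avgHess i.1.1 i.1.2.1 i.1.2.2 i.2.2.le U₀ X' (Pi.single bd E) y‖ ≤ 6 * (g L * ((L : ℝ) ^ (i.1.2.2 - i.1.2.1))⁻¹) * s * ‖E‖ := h
      _ = (6 * g L) * ((L : ℝ) ^ (i.1.2.2 - i.1.2.1))⁻¹ * s * ‖E‖ := by ring
  intro L hL i U₀ hU X s hX bd
  have h := hTJ_of_hHcol_hq α ΘH (fun L => 6 * g L) hα hΘH0 (fun L hL => by have := hg0 L hL; positivity) c₀ cB a hHcol hq L hL i U₀ hU X s hX bd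
  calc ‖(toL2 i.1.1 i.1.2.2 (c₀ L)).symm (TJSlotP i.1.1 i.1.2.1 i.1.2.2 i.2.2.le (c₀ L) (cB L) (a L i) U₀ (toL2 i.1.1 i.1.2.2 (c₀ L) X)) bd‖ ≤ 2 * α L * ΘH L * (6 * g L) * s := h
    _ = 12 * α L * ΘH L * g L * s := by ring

end Summit.QuantumFields.YangMills.Theorems.Prop7TJRowOfEntry157

end
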